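import Summits.BirchSwinnertonDyer.BirchSwinnertonDyer.Theorems.QuadraticBranchSignedControlPlusEtaNonsurjQuarticTwistGalois
import Summits.BirchSwinnertonDyer.BirchSwinnertonDyer.Theorems.QuadraticBranchSignedControlPlusEtaNonsurjGoodFrobenius
import Literature.NumberTheory.EllipticCurves.SerreOpenImageDeterminantProofs
import Literature.NumberTheory.EllipticCurves.ModPIrreducibleCongruenceTransferProofs
import Summits.BirchSwinnertonDyer.BirchSwinnertonDyer.Theorems.SignedLowerHalvesKobayashiMainConjectureSmallImageCMTransferRecordsD
import HarnessLib

/-!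
# Route `QuadraticBranchSignedControl` (rung K8, cell `bsd-potss`): crux stmt-BirchSwinnertonDyer-19606
# `PlusEtaMainConjectureNonsurj` — THE QUARTIC DOOR, PART II: a mod-`p` anchor with `j = 1728` (a quartic twist of `y² = x³ + x`) reads
# `a_ℓ(V)² ≡ a_ℓ(E₀)²` or `4ℓ − a_ℓ(E₀)²` (`p ≡ 3 (mod 4)`, `ℓ ≡ 1 (mod 4)`)

WHY. The `±` twist door of k8eta-c2 g14 (`…TwistedCongruenceTrace`) excludes anchors with `j ∉ {0, 1728}`; the rows of crux 19606 whose
Cartan field is `ℚ(i)` (h = 1) — `x = −3/7` at `p = 7` (anchored: `y² = x³ + 3x`, KO92) and `3P` at `p = 11` (anchor-free numerically) — have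
their possible anchors among the curves with `j = 1728`, i.e. the QUARTIC twists `y² = x³ + αx` of `E₀ : y² = x³ + x`, which the `±` door
cannot see. This file proves the quartic analogue: along a `ℚ̄`-isomorphism `A ≅ E₀` (`u⁴ = α`) an element `σ ∈ Γ_ℚ` FIXING `i` is
transported up to an automorphism `θ^k` of `E₀` (`θ(x, y) = (−x, iy)`, `θ² = −1`), so on `p`-torsion `tr ρ̄_A(σ) = tr(Θ^k ρ̄_{E₀}(σ))`; for a
`2 × 2` matrix `M` with `M² = −1` over a field in which `−1` is not a square (`𝔽_p`, `p ≡ 3 (mod 4)`) commuting with `F`: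
`tr(MF)² = 4 det F − tr(F)²`. Hence the door (§5): `V[p] ≅ A[p]`, `j(A) = 1728`, `p ≡ 3 (mod 4)`, `ℓ ≡ 1 (mod 4)` a good prime of `V`:
`a_ℓ(V)² ≡ a_ℓ(E₀)²` or `a_ℓ(V)² ≡ 4ℓ − a_ℓ(E₀)² (mod p)` — Gauss's `a_ℓ ∈ {±2a, ±2b}`, `ℓ = a² + b²`, in the form the kernel can check.

* Part I (`…QuarticTwistGalois`): the `2 × 2` lemma, the `ℚ̄`-isomorphism `exists_iso_of_j_eq_1728` with its Galois behaviour. Here: §4 `exists_torsionEquiv_of_addEquiv`, `matrix_eq_of_forall_mulVec_eq_aux` (private twin of g12's lemma);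
  §5 **`sq_frobeniusTrace_of_modPCongruent_of_j_eq_1728`** (the door);
  §6 `not_dvd_discOf_E0`, **`not_modPCongruent_of_j_eq_1728_of_counts`** (record form: one prime `ℓ ≡ 1 (4)` with
  `a_ℓ(V)² ∉ {a_ℓ(E₀)², 4ℓ − a_ℓ(E₀)²} (mod p)` excludes every `j = 1728` anchor). Application: `…UncongruentRecordsEleven01` row `3P`
  (witness `ℓ = 5`: `a₅(V) = 0`, `a₅(E₀) = 2`, `p = 11`); the anchored `p = 7` row `x = −3/7` passes the door at every `ℓ ≤ 200` (numerics).

HONEST FRAMING (cell `bsd-potss`, run/shared/lean/pub/bsd-potss/; FULL-BSD rank ≤ 1 programme): TOOL THEOREMS ONLY (no definition,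
no named fact, no `sorry`, axioms standard). Nothing is booked; crux 19606 stays OPEN. Seat `bsd-potss-k8eta-c2` g15 (prover),
`--supports stmt-BirchSwinnertonDyer-19606`.

References: [SilvermanAEC2009] X.5 Prop. 5.4 (twists by `Aut(E) = μ₄` for `j = 1728`), III.10, III.§7; [IrelandRosen1990] Ch. 18 §4
(`a_p` of `y² = x³ − Dx`); [Serre1981] §8.1 (238).
-/

set_option autoImplicit false
set_option linter.dupNamespace false

noncomputable section

open scoped Classical NumberField

open Field IsDedekindDomain NumberField WeierstrassCurve Literature.NumberTheory.EllipticCurves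
  Literature.NumberTheory.GaloisRepresentations Rat.HeightOneSpectrum
open Literature.NumberTheory.EllipticCurves.DeuringLadic
open Summit.BirchSwinnertonDyer.Rank1Residual.O6 (ModPCongruent)
open Summit.BirchSwinnertonDyer.BirchSwinnertonDyer.Rank1Residual.IntModel (integralModelInt_eq_of_map_eq map_mk_int minimalDiscriminantInt_eq)
open scoped Matrix
open Literature.NumberTheory.EllipticCurves.Rank1Residual.X11RankOneCertificates (discOf countPoints)

namespace Summit.BirchSwinnertonDyer.BirchSwinnertonDyer.Theorems.EtaCartanField

/-! ## §4 Torsion restriction and matrices in a frame -/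

/-- Restriction of an additive isomorphism `φ : X(ℚ̄) ≃+ Y(ℚ̄)` to the `n`-torsion, with its defining formula. [folklore] -/
theorem exists_torsionEquiv_of_addEquiv {X Y : WeierstrassCurve ℚ} (φ : X.geomPoints ≃+ Y.geomPoints) (n : ℤ) :
    ∃ e : X.geomTorsion n ≃+ Y.geomTorsion n, ∀ P : X.geomTorsion n, ((e P : Y.geomTorsion n) : Y.geomPoints) = φ P := by
  have hmem : ∀ P : X.geomPoints, P ∈ X.geomTorsion n → φ P ∈ Y.geomTorsion n := fun P hP => by
    rw [Submodule.mem_toAddSubgroup, Submodule.mem_torsionBy_iff] at hP ⊢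
    change n • φ P = 0
    rw [← map_zsmul, show n • P = 0 from hP, map_zero]
  have hmem' : ∀ Q : Y.geomPoints, Q ∈ Y.geomTorsion n → φ.symm Q ∈ X.geomTorsion n := fun Q hQ => by
    rw [Submodule.mem_toAddSubgroup, Submodule.mem_torsionBy_iff] at hQ ⊢
    change n • φ.symm Q = 0
    rw [← map_zsmul, show n • Q = 0 from hQ, map_zero]
  let f : X.geomTorsion n →+ Y.geomTorsion n :=
    ((φ : X.geomPoints →+ Y.geomPoints).comp (X.geomTorsion n).subtype).codRestrict (Y.geomTorsion n)
      fun P => hmem P.1 P.2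
  have hf : ∀ P : X.geomTorsion n, ((f P : Y.geomTorsion n) : Y.geomPoints) = φ P := fun _ => rfl
  have hbij : Function.Bijective f := by
    constructor
    · intro P Q h
      apply Subtype.ext
      exact φ.injective (by rw [← hf, ← hf, h])
    · intro Q
      refine ⟨⟨φ.symm Q, hmem' Q.1 Q.2⟩, Subtype.ext ?_⟩
      rw [hf]
      exact φ.apply_symm_apply Q
  exact ⟨AddEquiv.ofBijective f hbij, hf⟩

/-- Two `2 × 2` matrices over `𝔽_p` with the same action on every vector are equal. [folklore] -/
private theorem matrix_eq_of_forall_mulVec_eq_aux {p : ℕ} {M N : Matrix (Fin 2) (Fin 2) (ZMod p)}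
    (h : ∀ v : Fin 2 → ZMod p, M *ᵥ v = N *ᵥ v) : M = N :=
  Matrix.toLin'.injective (LinearMap.ext fun v => by rw [Matrix.toLin'_apply, Matrix.toLin'_apply, h])

/-! ## §5 The quartic door -/

-- `E₀ = [0,0,0,1,0]` (`64a4`): `Δ ≠ 0` and global minimality are the tree's `Theorems.isElliptic_cm64a4` / `isGloballyMinimal_cm64a4`
-- (`…SignedLowerHalvesKobayashiMainConjectureSmallImageCMTransferRecordsD`), reused.

/-- **THE QUARTIC DOOR.** Let `p ≡ 3 (mod 4)` be prime, `V/ℚ` globally minimal and `A/ℚ` an elliptic curve with `j(A) = 1728` and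
`V[p] ≅ A[p]` (`ModPCongruent V A p`). Then at every prime `ℓ ≡ 1 (mod 4)`, `ℓ ≠ p`, of good reduction for `V`:
`a_ℓ(V)² ≡ a_ℓ(E₀)²` or `a_ℓ(V)² ≡ 4ℓ − a_ℓ(E₀)² (mod p)`, `E₀ : y² = x³ + x`. (An arithmetic Frobenius `σ` at `ℓ` fixes `i` since
`ℓ ≡ 1 (mod 4)`; along the `ℚ̄`-isomorphism `A ≅ E₀` of §3 it is transported up to `θ^k`; in a frame of `E₀[p]` the matrices `M_θ`, `M_σ`
commute, `M_θ² = −1`, `tr M_σ = a_ℓ(E₀)`, `det M_σ = ℓ`, and `−1` is a non-square mod `p`; §1.) This is Gauss's theorem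
«`a_ℓ ∈ {±2a, ±2b}`, `ℓ = a² + b²`» for the quartic twists of `y² = x³ + x`, read modulo `p` through the congruence.
[cite: SilvermanAEC2009, X.5 Prop. 5.4 and Cor. 5.4.1] [cite: IrelandRosen1990, Ch. 18 §4] [cite: Serre1981, §8.1 (238)] -/
theorem sq_frobeniusTrace_of_modPCongruent_of_j_eq_1728 (V : WeierstrassCurve ℚ) [V.IsElliptic] [V.IsGloballyMinimal]
    (p : ℕ) [Fact p.Prime] (hp4 : p % 4 = 3) {A : WeierstrassCurve ℚ} [A.IsElliptic] (hVA : ModPCongruent V A p)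
    (hj : A.j = 1728) (ℓ : ℕ) [hℓ : Fact ℓ.Prime] (hℓ4 : ℓ % 4 = 1) (hℓp : ℓ ≠ p) (hgoodV : V.HasGoodReductionAtPrime ℓ) :
    haveI := isElliptic_cm64a4; haveI := isGloballyMinimal_cm64a4
    (p : ℤ) ∣ V.frobeniusTrace ℓ ^ 2 - (⟨0, 0, 0, 1, 0⟩ : WeierstrassCurve ℚ).frobeniusTrace ℓ ^ 2 ∨
      (p : ℤ) ∣ V.frobeniusTrace ℓ ^ 2 - (4 * ℓ - (⟨0, 0, 0, 1, 0⟩ : WeierstrassCurve ℚ).frobeniusTrace ℓ ^ 2) := by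
  haveI := isElliptic_cm64a4; haveI := isGloballyMinimal_cm64a4
  set E₀ : WeierstrassCurve ℚ := ⟨0, 0, 0, 1, 0⟩ with hE₀
  letI : Module (ZMod p) (V.geomTorsion p) := AddSubgroup.torsionBy.zmodModule
  letI : Module (ZMod p) (A.geomTorsion p) := AddSubgroup.torsionBy.zmodModule
  letI : Module (ZMod p) (E₀.geomTorsion p) := AddSubgroup.torsionBy.zmodModule
  have hℓP : ℓ.Prime := hℓ.out
  have hℓ2 : ℓ ≠ 2 := by intro h; rw [h] at hℓ4; norm_num at hℓ4
  -- `i ∈ ℚ̄` and an arithmetic Frobenius at `ℓ` fixing it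
  obtain ⟨I, hI⟩ := IsAlgClosed.exists_pow_nat_eq (-1 : AlgebraicClosure ℚ) two_pos
  obtain ⟨v, hv⟩ : ∃ v : HeightOneSpectrum (𝓞 ℚ), (primesEquiv v : ℕ) = ℓ :=
    ⟨primesEquiv.symm ⟨ℓ, hℓP⟩, by rw [Equiv.apply_symm_apply]⟩
  obtain ⟨𝔓, h𝔓⟩ := v.primesAbove_nonempty
  obtain ⟨σ, hσ⟩ := HeightOneSpectrum.exists_isArithFrobAt_of_mem_primesAbove_holds h𝔓
  have hsq : IsSquare (((-1 : ℤ) : ℤ) : ZMod ℓ) := by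
    rw [Int.cast_neg, Int.cast_one]; exact ZMod.exists_sq_eq_neg_one_iff.mpr (by rw [hℓ4]; decide)
  have hσI : σ • I = I :=
    smul_eq_self_of_isArithFrobAt hℓP hℓ2 (d := -1) (by rw [dvd_neg]; exact_mod_cast hℓP.one_lt.ne' ∘ Nat.dvd_one.mp) hsq
      (by rw [hI]; push_cast; ring) hv h𝔓 hσ
  -- good reduction of `E₀` at the odd prime `ℓ`
  have hgoodE : E₀.HasGoodReductionAtPrime ℓ := by
    refine E₀.hasGoodReductionAtPrime_of_not_dvd ℓ ?_
    have hIE : integralModelInt E₀ = ⟨0, 0, 0, 1, 0⟩ :=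
      integralModelInt_eq_of_map_eq _ (by rw [hE₀]; ext <;> simp [WeierstrassCurve.map])
    rw [minimalDiscriminantInt_eq hIE]
    intro h
    have h64 : (ℓ : ℤ) ∣ 64 := by
      have : (⟨0, 0, 0, 1, 0⟩ : WeierstrassCurve ℤ).Δ = -64 := by
        simp [WeierstrassCurve.Δ, WeierstrassCurve.b₂, WeierstrassCurve.b₄, WeierstrassCurve.b₆, WeierstrassCurve.b₈]
      rw [this, dvd_neg] at h; exact h
    have h2 : (ℓ : ℤ) ∣ 2 ^ 6 := by norm_num; exact h64
    have := Int.Prime.dvd_pow' hℓP h2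
    have h22 : ℓ ∣ 2 := by exact_mod_cast this
    exact hℓ2 ((Nat.prime_dvd_prime_iff_eq hℓP Nat.prime_two).mp h22)
  -- the `ℚ̄`-isomorphism `A ≅ E₀` with its quartic Galois behaviour, restricted to `p`-torsion
  obtain ⟨ι, θ, hθθ, hθg, hcases⟩ := exists_iso_of_j_eq_1728 hj hI
  obtain ⟨e₁, he₁⟩ := exists_torsionEquiv_of_addEquiv ι (p : ℤ)
  obtain ⟨T, hT⟩ := exists_torsionEquiv_of_addEquiv θ (p : ℤ)
  obtain ⟨e₀, he₀⟩ := hVA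
  -- a frame of `E₀[p]`
  obtain ⟨f, Φ, hf, -⟩ := exists_frame_galoisRepTorsion_rat E₀ p
  set MF : Matrix (Fin 2) (Fin 2) (ZMod p) :=
    ((Φ (galoisRepTorsion E₀ p σ) : GL (Fin 2) (ZMod p)) : Matrix (Fin 2) (Fin 2) (ZMod p)) with hMF
  set MT : Matrix (Fin 2) (Fin 2) (ZMod p) :=
    ((Φ (Multiplicative.ofAdd T) : GL (Fin 2) (ZMod p)) : Matrix (Fin 2) (Fin 2) (ZMod p)) with hMT
  have hfσ : ∀ Q : E₀.geomTorsion p, f (σ • Q) = MF *ᵥ f Q := fun Q => hf (galoisRepTorsion E₀ p σ) Q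
  have hfT : ∀ Q : E₀.geomTorsion p, f (T Q) = MT *ᵥ f Q := fun Q => hf (Multiplicative.ofAdd T) Q
  -- `T (T Q) = -Q`, `T (σ Q) = σ (T Q)` on torsion
  have hTT : ∀ Q : E₀.geomTorsion p, T (T Q) = -Q := fun Q => Subtype.ext (by
    rw [hT, hT, AddSubgroup.coe_neg, hθθ])
  have hTσ : ∀ Q : E₀.geomTorsion p, T (σ • Q) = σ • T Q := fun Q => Subtype.ext (by
    rw [hT]; change θ (σ • (Q : E₀.geomPoints)) = σ • ((T Q : E₀.geomTorsion p) : E₀.geomPoints); rw [hT, hθg σ hσI])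
  -- matrix relations
  have hMTT : MT * MT = -1 := matrix_eq_of_forall_mulVec_eq_aux fun w => by
    obtain ⟨Q, rfl⟩ := f.surjective w
    rw [← Matrix.mulVec_mulVec, ← hfT, ← hfT, hTT, map_neg, Matrix.neg_mulVec, Matrix.one_mulVec]
  have hMTF : MT * MF = MF * MT := matrix_eq_of_forall_mulVec_eq_aux fun w => by
    obtain ⟨Q, rfl⟩ := f.surjective w
    rw [← Matrix.mulVec_mulVec, ← Matrix.mulVec_mulVec, ← hfσ, ← hfT, hTσ, hfσ, hfT]
  have hnsq : ¬ IsSquare (-1 : ZMod p) := fun h => (ZMod.exists_sq_eq_neg_one_iff.mp h) hp4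
  have key := trace_mul_sq_of_mul_self_eq_neg_one hMTT hnsq hMTF
  -- traces and determinant
  have htrE : MF.trace = (E₀.frobeniusTrace ℓ : ZMod p) := by
    rw [← trace_eq_matrix_trace f hfσ]; exact E₀.trace_galoisRepTorsion_frobenius_eq p hℓp hgoodE hv h𝔓 hσ
  have hdetE : MF.det = (ℓ : ZMod p) := by
    rw [← det_eq_matrix_det f hfσ]; exact E₀.det_galoisRepTorsion_frobenius_eq p hℓp hgoodE hv h𝔓 hσ
  have htrV : LinearMap.trace (ZMod p) (V.geomTorsion p) ((galoisRepTorsion V p σ).toAdd.toAddMonoidHom.toZModLinearMap p) =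
      (V.frobeniusTrace ℓ : ZMod p) := V.trace_galoisRepTorsion_frobenius_eq p hℓp hgoodV hv h𝔓 hσ
  have htrVA : LinearMap.trace (ZMod p) (V.geomTorsion p) ((galoisRepTorsion V p σ).toAdd.toAddMonoidHom.toZModLinearMap p) =
      LinearMap.trace (ZMod p) (A.geomTorsion p) ((galoisRepTorsion A p σ).toAdd.toAddMonoidHom.toZModLinearMap p) := by
    have h1 := trace_eq_mul_trace_of_twistedIso e₀ (σ := σ) (s := 1) (fun P => by rw [he₀, one_zsmul])
    rw [Int.cast_one, one_mul] at h1; exact h1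
  -- the composite frame `f ∘ e₁` of `A[p]`
  let f' : A.geomTorsion p ≃+ (Fin 2 → ZMod p) := e₁.trans f
  have hf' : ∀ P, f' P = f (e₁ P) := fun _ => rfl
  -- the coercion of `e₁ (σ • P)` in the four cases
  have hcoeσ : ∀ P : A.geomTorsion p, ((σ • P : A.geomTorsion p) : A.geomPoints) = σ • (P : A.geomPoints) := fun _ => rfl
  rcases hcases σ hσI with h1 | h2 | h3 | h4
  · -- `e₁ (σ P) = σ (e₁ P)`: `tr ρ̄_A(σ) = tr MF`
    have hrel : ∀ P : A.geomTorsion p, e₁ (σ • P) = σ • e₁ P := fun P => Subtype.ext (by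
      rw [he₁, hcoeσ, h1]; change σ • ι (P : A.geomPoints) = σ • ((e₁ P : E₀.geomTorsion p) : E₀.geomPoints); rw [he₁])
    have hσ' : ∀ P : A.geomTorsion p, f' (σ • P) = MF *ᵥ f' P := fun P => by rw [hf', hf', hrel, hfσ]
    have htrA := trace_eq_matrix_trace f' hσ'
    left
    rw [← ZMod.intCast_zmod_eq_zero_iff_dvd]; push_cast
    rw [← htrV, htrVA, htrA, htrE]; ring
  · have hrel : ∀ P : A.geomTorsion p, e₁ (σ • P) = -(σ • e₁ P) := fun P => Subtype.ext (by
      rw [he₁, hcoeσ, h2, AddSubgroup.coe_neg]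
      change -(σ • ι (P : A.geomPoints)) = -(σ • ((e₁ P : E₀.geomTorsion p) : E₀.geomPoints)); rw [he₁])
    have hσ' : ∀ P : A.geomTorsion p, f' (σ • P) = (-MF) *ᵥ f' P := fun P => by
      rw [hf', hf', hrel, map_neg, hfσ, Matrix.neg_mulVec]
    have htrA := trace_eq_matrix_trace f' hσ'
    left
    rw [← ZMod.intCast_zmod_eq_zero_iff_dvd]; push_cast
    rw [← htrV, htrVA, htrA, Matrix.trace_neg, htrE]; ring
  · -- `θ (ι (σ P)) = σ (ι P)`: `T (e₁ (σ P)) = σ (e₁ P)`, so `f' (σ P) = -(MT MF) f' P`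
    have hrel : ∀ P : A.geomTorsion p, T (e₁ (σ • P)) = σ • e₁ P := fun P => Subtype.ext (by
      rw [hT, he₁, hcoeσ, h3]; change σ • ι (P : A.geomPoints) = σ • ((e₁ P : E₀.geomTorsion p) : E₀.geomPoints); rw [he₁])
    have hσ' : ∀ P : A.geomTorsion p, f' (σ • P) = (-(MT * MF)) *ᵥ f' P := fun P => by
      have h5 : MT *ᵥ f' (σ • P) = MF *ᵥ f' P := by rw [hf', hf', ← hfT, hrel, hfσ]
      have h6 : f' (σ • P) = -(MT *ᵥ (MT *ᵥ f' (σ • P))) := by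
        rw [Matrix.mulVec_mulVec, hMTT, Matrix.neg_mulVec, Matrix.one_mulVec, neg_neg]
      rw [h6, h5, Matrix.mulVec_mulVec, Matrix.neg_mulVec]
    have htrA := trace_eq_matrix_trace f' hσ'
    right
    rw [← ZMod.intCast_zmod_eq_zero_iff_dvd]; push_cast
    rw [← htrV, htrVA, htrA, Matrix.trace_neg, neg_sq, key, hdetE, htrE]; ring
  · -- `ι (σ P) = θ (σ (ι P))`: `f' (σ P) = (MT MF) f' P`
    have hrel : ∀ P : A.geomTorsion p, e₁ (σ • P) = T (σ • e₁ P) := fun P => Subtype.ext (by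
      rw [he₁, hcoeσ, h4, hT]; change θ (σ • ι (P : A.geomPoints)) = θ (σ • ((e₁ P : E₀.geomTorsion p) : E₀.geomPoints)); rw [he₁])
    have hσ' : ∀ P : A.geomTorsion p, f' (σ • P) = (MT * MF) *ᵥ f' P := fun P => by
      rw [hf', hf', hrel, hfT, hfσ, Matrix.mulVec_mulVec]
    have htrA := trace_eq_matrix_trace f' hσ'
    right
    rw [← ZMod.intCast_zmod_eq_zero_iff_dvd]; push_cast
    rw [← htrV, htrVA, htrA, key, hdetE, htrE]; ring

/-! ## §6 The quartic door from point counts (record form) -/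

/-- `Δ([0,0,0,1,0]) = −64`: an odd prime does not divide it. [folklore] -/
theorem not_dvd_discOf_E0 (ℓ : ℕ) (hℓ : ℓ.Prime) (hℓ2 : ℓ ≠ 2) : ¬ (ℓ : ℤ) ∣ discOf [0, 0, 0, 1, 0] := by
  rw [show discOf [0, 0, 0, 1, 0] = -64 by decide, dvd_neg]
  intro h
  have h2 : (ℓ : ℤ) ∣ 2 ^ 6 := by norm_num; exact h
  have h22 : ℓ ∣ 2 := by exact_mod_cast Int.Prime.dvd_pow' hℓ h2
  exact hℓ2 ((Nat.prime_dvd_prime_iff_eq hℓ Nat.prime_two).mp h22)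

/-- **Quartic door from counts.** `V` (integral model `[a₁,…,a₆]`, globally minimal) is `p`-congruent (`p ≡ 3 (mod 4)`) to NO curve `A` with
`j(A) = 1728` as soon as one prime `ℓ ≡ 1 (mod 4)`, `ℓ ≠ p`, `ℓ ∤ Δ(V)` has `a_ℓ(V)² ≢ a_ℓ(E₀)²` AND `a_ℓ(V)² ≢ 4ℓ − a_ℓ(E₀)² (mod p)`, the traces
read off `countPoints` (`E₀ = [0,0,0,1,0]`). [cite: SilvermanAEC2009, X.5 Prop. 5.4] [cite: IrelandRosen1990, Ch. 18 §4] -/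
theorem not_modPCongruent_of_j_eq_1728_of_counts (V : WeierstrassCurve ℚ) [V.IsElliptic] [V.IsGloballyMinimal] (p : ℕ)
    [Fact p.Prime] (hp4 : p % 4 = 3) {a1 a2 a3 a4 a6 : ℤ} (hI : integralModelInt V = ⟨a1, a2, a3, a4, a6⟩)
    {A : WeierstrassCurve ℚ} [A.IsElliptic] (hj : A.j = 1728)
    (ℓ : ℕ) [hℓ : Fact ℓ.Prime] (hℓ4 : ℓ % 4 = 1) (hℓp : ℓ ≠ p) (hΔ : ¬ (ℓ : ℤ) ∣ discOf [a1, a2, a3, a4, a6])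
    (h1 : ¬ (p : ℤ) ∣ ((ℓ : ℤ) + 1 - countPoints [a1, a2, a3, a4, a6] ℓ) ^ 2 - ((ℓ : ℤ) + 1 - countPoints [0, 0, 0, 1, 0] ℓ) ^ 2)
    (h2 : ¬ (p : ℤ) ∣ ((ℓ : ℤ) + 1 - countPoints [a1, a2, a3, a4, a6] ℓ) ^ 2 -
      (4 * ℓ - ((ℓ : ℤ) + 1 - countPoints [0, 0, 0, 1, 0] ℓ) ^ 2)) :
    ¬ ModPCongruent V A p := by
  intro hVA
  haveI := isElliptic_cm64a4; haveI := isGloballyMinimal_cm64a4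
  have hℓ2 : ℓ ≠ 2 := by intro h; rw [h] at hℓ4; norm_num at hℓ4
  obtain ⟨hgV, htV⟩ := EtaUncongruentRecords.good_and_frobeniusTrace_eq_of_countPoints hI ℓ hℓ2 hΔ
  have hIE : integralModelInt (⟨0, 0, 0, 1, 0⟩ : WeierstrassCurve ℚ) = ⟨0, 0, 0, 1, 0⟩ :=
    integralModelInt_eq_of_map_eq _ (map_mk_int 0 0 0 1 0)
  obtain ⟨-, htE⟩ := EtaUncongruentRecords.good_and_frobeniusTrace_eq_of_countPoints hIE ℓ hℓ2 (not_dvd_discOf_E0 ℓ hℓ.out hℓ2)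
  rcases sq_frobeniusTrace_of_modPCongruent_of_j_eq_1728 V p hp4 hVA hj ℓ hℓ4 hℓp hgV with h | h
  · exact h1 (by rw [← htV, ← htE]; exact h)
  · exact h2 (by rw [← htV, ← htE]; exact h)

end Summit.BirchSwinnertonDyer.BirchSwinnertonDyer.Theorems.EtaCartanField

end
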